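import Mathlib
import HarnessLib
import Literature.Analysis.FluidPDE.ClassicalSolution
import Literature.Analysis.FluidPDE.SuitableWeak
import Literature.Analysis.FluidPDE.TaoLocalisation
import Literature.Analysis.FluidPDE.TaoEnstrophyLocalisation
import Literature.Analysis.FluidPDE.SpaceTimeRescaling
import Literature.Analysis.FluidPDE.ClassicalSolutionRescale
import Literature.Analysis.FluidPDE.ClassicalNSIRescale
import Literature.Analysis.FluidPDE.ClassicalBoundedUniformDerivativeBounds

/-!
# Shelf 1574, LINE 7 twin `lamb_budget_vorticity`: Type I for `u` forces Type I for `∇u`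
# (`stub_gradientTypeI : GradientTypeIOfTypeI`)

Helper file (`--supports stmt-NavierStokesRegularity-1574 --as helper`). Stub `stub_gradientTypeI` of ns-idea-9's
LINE 7 TWIN `Cruxes/EnstrophyQuarterLaw/Lines/lamb_budget_vorticity.lean` ("KNOWN (M–L to vendor)"; idea-crit-8
V30a: "GradientTypeIOfTypeI TRUE/KNOWN (same smoothing as VorticityTypeI)"), signature VERBATIM with the
Cruxes-local predicate `GradientTypeI` unfolded: for a maximal classical Leray–Hopf solution from a rapidly decaying
datum, the sup-rate Type-I bound `|u(t,x)| ≤ C₀/√(T−t)` near `T` implies the GRADIENT Type-I rate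
`‖∇u(t,x)‖ ≤ C/(T−t)` near `T`.

PROOF — the KNSS Type-I zoom of the sibling file `…EnstrophyQuarterLawVorticityTypeI.lean` (ns-hhe-c1 g3, p621875),
stopped one line earlier (that proof bounds `‖∇u(t,x)‖ ≤ C₁/β`, `β = (T−t)/2`, and only then passes to the curl);
nothing is re-derived: the tree's Koch–Nadirashvili–Seregin–Šverák smoothing estimate for bounded classical
solutions with constants chosen before the solution (`exists_uniform_iteratedFDeriv_bound_of_bounded_classical`,
KNSS 2009 (4.10)) is applied to the parabolic zoom `v(s,y) = (R/ν) u(t − β + βs, Ry)`, `R = √(νβ)`, a classical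
unit-viscosity solution on `s ∈ [0, 3/2]` (`IsClassicalNSSolutionOn.stRescale`) living in the physical window
`[t − β, t + β/2] ⊂ (T₁, T)` where the rate holds, so `|v| ≤ C₀/√ν`; KNSS at `s = 1` (`δ = 1/2`, `k = 1`) bounds
`‖∇v(1)‖ ≤ C₁`, and un-zooming (`fderiv_smul_stPull_slice`: `∇v(1, y) = β ∇u(t, Ry)`) gives
`‖∇u(t)‖ ≤ C₁/β = 2C₁/(T−t)`. The vorticity rate of p621875 is the corollary `|curl u| ≤ ‖curlCLM‖ ‖∇u‖`.

HONEST FRAMING: bookkeeping about ONE hypothetical Type-I blow-up; nothing here bears on the regularity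
problem; the Type-I wall (0056), `EnstrophyQuarterLaw` (1574) and the twin's crux B_ω (`VorticitySparsenessLaw`)
stay OPEN. No summit statement is proved.
-/

noncomputable section

-- the summit-side namespace repeats a component by design (D-0017)
set_option linter.dupNamespace false

namespace Summit.NavierStokesRegularity.NavierStokesRegularity.Theorems.EnstrophyQuarterLaw.LambBudget

open Set MeasureTheory Function Metric Filter Topology
open scoped ENNReal NNReal
open Literature.Analysis.FluidPDE

/-- **`GradientTypeIOfTypeI` of `Lines/lamb_budget_vorticity.lean` (stub `stub_gradientTypeI`, signature VERBATIM
with `GradientTypeI` unfolded).** For a maximal classical Leray–Hopf solution from a rapidly decaying datum, the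
sup-rate Type-I bound for `u` at `T` implies the sup-rate Type-I bound `‖∇u(t,x)‖ ≤ C/(T−t)` for the velocity
gradient as `t ↑ T` (KNSS 2009 (4.10) smoothing of bounded classical solutions at the Type-I parabolic scale;
Giga–Inui–Matsui / KNSS `L^∞` smoothing).
[cite: KochNadirashviliSereginSverak2009, Prop. 4.1 with (4.6) and §4 (4.10) (arXiv:0709.3599v1 p. 8)] -/
theorem gradientTypeIOfTypeI :
    ∀ (ν T : ℝ), 0 < ν → 0 < T →
    ∀ (u : ℝ → EuclideanSpace ℝ (Fin 3) → EuclideanSpace ℝ (Fin 3)) (p : ℝ → EuclideanSpace ℝ (Fin 3) → ℝ),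
    IsMaximalSmoothSolution ν 0 u p T → IsLerayHopfOn T ν 0 (u 0) u → HasRapidSpatialDecay (u 0) →
    IsTypeIBlowup u T →
    ∃ C : ℝ, ∀ᶠ t in nhdsWithin T (Set.Iio T), ∀ x, ‖fderiv ℝ (u t) x‖ ≤ C / (T - t) := by
  intro ν T hν hT u p hmax hLH _hdec hI
  obtain ⟨C₀, hC₀⟩ := hI
  have hsol : IsClassicalNSSolutionOn (Ico 0 T) ν 0 u p := hmax.1
  -- the window `(T₁, T)` where the rate holds, with `T₁ ≥ 0`
  obtain ⟨T₁, hT₁T, hT₁0, hrate⟩ : ∃ T₁ < T, 0 ≤ T₁ ∧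
      ∀ s ∈ Ioo T₁ T, ∀ x, ‖u s x‖ ≤ C₀ / Real.sqrt (T - s) := by
    obtain ⟨T₁, hT₁, hsub⟩ := mem_nhdsLT_iff_exists_Ioo_subset.1 hC₀
    refine ⟨max T₁ 0, max_lt hT₁ hT, le_max_right _ _, fun s hs => hsub ⟨?_, hs.2⟩⟩
    exact lt_of_le_of_lt (le_max_left _ _) hs.1
  have hC₀0 : 0 ≤ C₀ := by
    set s : ℝ := (T₁ + T) / 2 with hs
    have hsI : s ∈ Ioo T₁ T := ⟨by rw [hs]; linarith, by rw [hs]; linarith⟩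
    have h := hrate s hsI 0
    have hsq : 0 < Real.sqrt (T - s) := Real.sqrt_pos.2 (by linarith [hsI.2])
    have : 0 ≤ C₀ / Real.sqrt (T - s) := (norm_nonneg _).trans h
    rwa [le_div_iff₀ hsq, zero_mul] at this
  -- the KNSS constant for bound `N` on the slab `[0, 3/2]`, chosen before `t`
  set N : ℝ := C₀ * Real.sqrt ν / ν + 1 with hN
  have hNpos : 0 < N := by positivity
  obtain ⟨C, hC⟩ := exists_uniform_iteratedFDeriv_bound_of_bounded_classical N (3 / 2) (by norm_num)
  set T₂ : ℝ := (2 * T₁ + T) / 3 with hT₂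
  have hT₂T : T₂ < T := by rw [hT₂]; linarith
  refine ⟨2 * C 1 (1 / 2), ?_⟩
  filter_upwards [Ioo_mem_nhdsLT hT₂T] with t ht
  intro x
  have hTt : 0 < T - t := sub_pos.2 ht.2
  -- ### the zoom about the time `t` at the Type-I scale
  set β : ℝ := (T - t) / 2 with hβ
  have hβpos : 0 < β := by positivity
  set R : ℝ := Real.sqrt ν * Real.sqrt β with hR
  have hRpos : 0 < R := by positivity
  set α : ℝ := R / ν with hα
  have hαpos : 0 < α := by positivity
  have hsqν : Real.sqrt ν ^ 2 = ν := Real.sq_sqrt hν.le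
  have hsqβ : Real.sqrt β ^ 2 = β := Real.sq_sqrt hβpos.le
  have hαR : α * R = β := by
    rw [hα, hR, div_mul_eq_mul_div, ← pow_two, mul_pow, hsqν, hsqβ]
    field_simp
  have hβeq : β = α * R := hαR.symm
  have hvisc : α * ν / R = 1 := by
    rw [hα, div_mul_cancel₀ R hν.ne', div_self hRpos.ne']
  set t₀ : ℝ := t - β with ht₀
  -- the physical window of the zoom
  have hwin : ∀ s ∈ Icc (0 : ℝ) (3 / 2), t₀ + β * s ∈ Ico 0 T ∧ T₁ < t₀ + β * s ∧
      β ≤ T - (t₀ + β * s) := by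
    intro s hs
    have h1 : t₀ + β * s = t + β * (s - 1) := by rw [ht₀]; ring
    rw [h1]
    have hlo : -β ≤ β * (s - 1) := by nlinarith [hs.1]
    have hhi : β * (s - 1) ≤ β / 2 := by nlinarith [hs.2]
    refine ⟨⟨?_, ?_⟩, ?_, ?_⟩
    · have : T / 3 ≤ t := by
        have : T₂ ≥ T / 3 := by rw [hT₂]; linarith
        linarith [ht.1]
      rw [hβ] at hlo ⊢; linarith
    · rw [hβ] at hhi ⊢; linarith
    · have : (2 * T₁ + T) / 3 < t := ht.1
      rw [hβ] at hlo ⊢; linarith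
    · rw [hβ] at hhi ⊢; linarith
  -- the zoom is a classical unit-viscosity solution on `[0, 3/2]`
  have hcl : IsClassicalNSSolutionOn (Icc 0 (3 / 2)) 1 0 (α • stPull β R t₀ 0 u)
      (α ^ 2 • stPull β R t₀ 0 p) := by
    have h0 := hsol.stRescale hαpos hRpos hβeq t₀ 0
    rw [hvisc, smul_stPull_zero] at h0
    exact h0.mono (fun s hs => (hwin s hs).1) (uniqueDiffOn_Icc (by norm_num))
  -- finite energy on the slab
  have hE : ∃ Ce : ℝ≥0∞, Ce < ⊤ ∧ ∀ s ∈ Icc (0 : ℝ) (3 / 2),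
      ∫⁻ y, ‖(α • stPull β R t₀ 0 u) s y‖ₑ ^ 2 ≤ Ce := by
    refine ⟨‖α‖ₑ ^ 2 * (ENNReal.ofReal (R ^ 3)⁻¹ *
      ENNReal.ofReal (2 * VectorCalculus.kineticEnergy (u 0))),
      ENNReal.mul_lt_top (by simp) (ENNReal.mul_lt_top ENNReal.ofReal_lt_top ENNReal.ofReal_lt_top),
      fun s hs => ?_⟩
    have hτ := (hwin s hs).1
    have e : ∀ y : EuclideanSpace ℝ (Fin 3), ‖(α • stPull β R t₀ 0 u) s y‖ₑ ^ 2 =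
        ‖α‖ₑ ^ 2 * ‖u (t₀ + β * s) ((0 : EuclideanSpace ℝ (Fin 3)) + R • y)‖ₑ ^ 2 := by
      intro y
      rw [smul_stPull_apply, enorm_smul, mul_pow]
    simp_rw [e]
    rw [lintegral_const_mul' _ _ (by simp),
      lintegral_comp_space_affine hRpos (0 : EuclideanSpace ℝ (Fin 3))
        (fun z => ‖u (t₀ + β * s) z‖ₑ ^ 2), finrank_euclideanSpace_fin]
    exact mul_le_mul' le_rfl (mul_le_mul' le_rfl
      (hLH.lintegral_enorm_sq_le hν.le ⟨hτ.1, hτ.2.le⟩))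
  -- the zoom is bounded by `N`
  have hbd : ∀ s ∈ Icc (0 : ℝ) (3 / 2), ∀ y, ‖(α • stPull β R t₀ 0 u) s y‖ ≤ N := by
    intro s hs y
    obtain ⟨hτI, hτ1, hτβ⟩ := hwin s hs
    rw [smul_stPull_apply, norm_smul, Real.norm_of_nonneg hαpos.le]
    have hb := hrate _ ⟨hτ1, hτI.2⟩ ((0 : EuclideanSpace ℝ (Fin 3)) + R • y)
    have hsτ : Real.sqrt β ≤ Real.sqrt (T - (t₀ + β * s)) := Real.sqrt_le_sqrt hτβ
    have hsβ : 0 < Real.sqrt β := Real.sqrt_pos.2 hβpos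
    have h1 : ‖u (t₀ + β * s) (0 + R • y)‖ ≤ C₀ / Real.sqrt β :=
      hb.trans (div_le_div_of_nonneg_left hC₀0 hsβ hsτ)
    have h2 : α * (C₀ / Real.sqrt β) = C₀ * Real.sqrt ν / ν := by
      rw [hα, hR]
      field_simp
    calc α * ‖u (t₀ + β * s) (0 + R • y)‖ ≤ α * (C₀ / Real.sqrt β) :=
          mul_le_mul_of_nonneg_left h1 hαpos.le
      _ = C₀ * Real.sqrt ν / ν := h2
      _ ≤ N := by rw [hN]; linarith
  -- ### KNSS at the rescaled time `s = 1`, i.e. the physical time `t`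
  have hK := hC hcl hE hNpos hbd (1 / 2) (by norm_num) 1 1 ⟨by norm_num, by norm_num⟩ (R⁻¹ • x)
  have ht1 : t₀ + β * 1 = t := by rw [ht₀]; ring
  have hdiff : Differentiable ℝ (u (t₀ + β * 1)) := by
    rw [ht1]
    exact (hsol.contDiff_velocity ⟨by linarith [(hwin 1 ⟨by norm_num, by norm_num⟩).1.1], ht.2⟩).differentiable
      (by simp)
  have hfd : ‖fderiv ℝ ((α • stPull β R t₀ 0 u) 1) (R⁻¹ • x)‖ = β * ‖fderiv ℝ (u t) x‖ := by
    rw [fderiv_smul_stPull_slice hdiff, norm_smul, Real.norm_of_nonneg (by positivity), hαR, ht1,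
      zero_add, smul_smul, mul_inv_cancel₀ hRpos.ne', one_smul]
  have hiter : ‖iteratedFDeriv ℝ 1 ((α • stPull β R t₀ 0 u) 1) (R⁻¹ • x)‖ =
      ‖fderiv ℝ ((α • stPull β R t₀ 0 u) 1) (R⁻¹ • x)‖ := by
    rw [← norm_iteratedFDeriv_zero (𝕜 := ℝ) (f := fderiv ℝ ((α • stPull β R t₀ 0 u) 1)),
      norm_iteratedFDeriv_fderiv]
  rw [hiter, hfd] at hK
  -- `‖∇u(t,x)‖ ≤ C₁/β = 2C₁/(T - t)`
  have hgrad : ‖fderiv ℝ (u t) x‖ ≤ C 1 (1 / 2) / β := by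
    rw [le_div_iff₀ hβpos, mul_comm]; exact hK
  calc ‖fderiv ℝ (u t) x‖ ≤ C 1 (1 / 2) / β := hgrad
    _ = 2 * C 1 (1 / 2) / (T - t) := by rw [hβ]; field_simp

/-- **Corollary (the vorticity rate of p621875, re-derived from the gradient rate in one line):** under the same
hypotheses `|curl u(t,x)| ≤ C/(T−t)` near `T`, with `C = ‖curlCLM‖ · C_∇`. Recorded so that consumers of the twin
line can cite both rates from one import. [cite: KochNadirashviliSereginSverak2009, §4 (4.10)] -/
theorem vorticityTypeI_of_gradientTypeI {T : ℝ}
    {u : ℝ → EuclideanSpace ℝ (Fin 3) → EuclideanSpace ℝ (Fin 3)}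
    (hG : ∃ C : ℝ, ∀ᶠ t in nhdsWithin T (Set.Iio T), ∀ x, ‖fderiv ℝ (u t) x‖ ≤ C / (T - t)) :
    ∃ C : ℝ, ∀ᶠ t in nhdsWithin T (Set.Iio T), ∀ x, ‖curl (u t) x‖ ≤ C / (T - t) := by
  obtain ⟨C, hC⟩ := hG
  set κ : ℝ := ‖(Literature.Analysis.FluidPDE.curlCLM :
    (EuclideanSpace ℝ (Fin 3) →L[ℝ] EuclideanSpace ℝ (Fin 3)) →L[ℝ] EuclideanSpace ℝ (Fin 3))‖ with hκ
  have hκ0 : 0 ≤ κ := by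
    rw [hκ]
    exact norm_nonneg (Literature.Analysis.FluidPDE.curlCLM :
      (EuclideanSpace ℝ (Fin 3) →L[ℝ] EuclideanSpace ℝ (Fin 3)) →L[ℝ] EuclideanSpace ℝ (Fin 3))
  refine ⟨κ * C, ?_⟩
  filter_upwards [hC, self_mem_nhdsWithin] with t ht htT
  intro x
  have hTt : 0 < T - t := sub_pos.2 htT
  calc ‖curl (u t) x‖ ≤ κ * ‖fderiv ℝ (u t) x‖ := norm_curl_le (u t) x
    _ ≤ κ * (C / (T - t)) := mul_le_mul_of_nonneg_left (ht x) hκ0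
    _ = κ * C / (T - t) := by rw [mul_div_assoc]

end Summit.NavierStokesRegularity.NavierStokesRegularity.Theorems.EnstrophyQuarterLaw.LambBudget

end
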